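import Literature.NumberTheory.Transcendental.KaehlerIdentityEdgeDegreeProofs
import Literature.NumberTheory.Transcendental.KaehlerHodgeLaplacianDProofs
import Literature.NumberTheory.Transcendental.KaehlerHodgeStarStarProofs

/-!
# The Kähler identities in `Λ`-form from `[∂̄*, L] = i∂`, and `Δ_d = 2Δ_∂̄` on a Kähler manifold

Trunk **T-KAEHLER** (`NumberTheory/Transcendental`), theorems-only file serving the named fact
`Literature.NumberTheory.Transcendental.cHodgeLaplacian_eq_two_smul_dolbeaultLaplacian_of_isManifold_complex g o`
of `KaehlerHodge.lean` — the Kähler identity `Δ_d = 2Δ_∂̄` (Voisin (2002), §6.1.2, Thm. 6.7;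
Huybrechts (2005), Prop. 3.1.12 (iii)) — on which the Hodge decomposition
(`Literature.AlgebraicGeometry.Motives.isInternal_hodgePQ`, via `HodgeDecompositionIsInternalProofs.lean`)
and its harmonic siblings of `KaehlerHodge.lean` wait.

## The printed proof and what the tree had

Voisin proves Thm. 6.7 from the first-order identities of Prop. 6.5, `[Λ, ∂̄] = -i∂*`,
`[Λ, ∂] = i∂̄*` (eq. (6.3), p. 139), themselves "the adjoints" (conjugates by `⋆` and complex
conjugation) of `[∂̄*, L] = i∂` (Lemma 6.6 on `ℂⁿ`, globalised by the osculation Prop. 3.14).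
In the tree: the algebra Prop. 6.5 ⇒ Thm. 6.7 is `KaehlerIdentities.cHodgeLaplacian_eq_two_smul_dolbeaultLaplacian`
(`KaehlerHodgeLaplacianDProofs.lean`, for any contraction family `Λ` satisfying the hypothesis
structure `KaehlerIdentities o Λ`), and the `L`-form identity `P := [∂̄*, L] - i∂ = 0` is
`kaehlerP_apply_eq_zero` / `…_zero` (`KaehlerIdentityAssemblyProofs.lean`, degrees `≤ n - 2` and
functions) and `kaehlerP_apply_eq_zero_one` (`KaehlerIdentityEdgeDegreeProofs.lean`, the edge
degree `n - 1`). This file supplies the missing link: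

* §Algebra — **`⋆`-conjugation.** For `Λ_j := (-1)^j ⋆L⋆` on `(j+2)`-forms (the adjoint
  `⋆⁻¹L⋆` of `L`, written `SLS` = `⋆ L ⋆` in the statements) and smooth `β`:
  `sls_comm_dolbeault` (`Λ(∂β) - ∂(Λβ) = i∂̄*β`, generic degrees, from `P(⋆β) = 0` by applying `⋆`,
  `⋆⋆ = (-1)^{deg}` in even dimension and the parity bookkeeping `neg_one_pow_mul_eq_neg_one_pow`),
  `sls_comm_dolbeault_top` (top degree, from `P₀`), `sls_comm_dolbeault_one` (`1`-forms, from the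
  edge-degree `P₁`); and their complex conjugates `sls_comm_dolbeaultBar{,_top,_one}`
  (`[Λ, ∂̄] = -i∂*`; `⋆` and `L` are real: `lform_conj`, `sls_conj`). Voisin (2002), §6.1.1,
  Prop. 6.5; Huybrechts (2005), Prop. 3.1.12 (i) ⇔ (ii).
* §Assembly — `exists_kaehlerIdentities_of_kaehlerP`: from `P = 0` in all degrees, the family
  `Λ` (as a `dite` in the degree, `0` above the top) satisfies `KaehlerIdentities o Λ`; `Λ` is
  produced existentially, no definition is introduced.
* §NamedFact — `cHodgeLaplacian_eq_two_smul_dolbeaultLaplacian_of_isManifold_complex_of_kaehlerP₁`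
  (the fact from `P₁ = 0` alone, the rest being in the tree) and
  **`cHodgeLaplacian_eq_two_smul_dolbeaultLaplacian_of_isManifold_complex_of_t2Space`**: the named
  fact `… g o` for every smooth metric `g` and orientation family `o` on a **Hausdorff** complex
  manifold (`[T2Space M]`), all degrees.

## Why `[T2Space M]`, and what is (not) discharged

The osculation proofs of `P = 0` use Mathlib's smooth bump functions (`SmoothBumpFunction`,
`T2Space M`). The `def` of the named fact binds `[IsManifold 𝓘(ℂ, E) ω M] [IsManifold 𝓘(ℝ, E) ∞ M]`
but no separation axiom, i.e. it also speaks about non-Hausdorff complex manifolds — more than its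
source (Voisin's and Huybrechts' manifolds are Hausdorff by definition); the identity being local it
stays true there, but a proof would restrict to Hausdorff chart domains (forms on open
submanifolds), which is not attempted. Hence this file does **not** declare
`cHodgeLaplacian_eq_two_smul_dolbeaultLaplacian_of_isManifold_complex_holds`; it proves the fact
under `[T2Space M]`, which is what every consumer in the tree has in scope (they all assume
`[CompactSpace M] [T2Space M]`: `HodgeDecompositionIsInternalProofs.lean`,
`HodgeDecompositionProofs.lean`, `KaehlerHodgeSymm*`, …). No named fact is introduced (D-0026).

Implementation note: `KaehlerHodgeConjProofs.lean` is deliberately not imported (its import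
closure, through `ComplexDeRhamRealStructure.lean`, makes instance search diverge on the
metavariable degree of the `Lform` notation); the three conjugation lemmas needed
(`⋆ᾱ = \overline{⋆α}`, `∂̄*ᾱ = \overline{∂*α}`, `\overline{-α} = -ᾱ`) are re-proved privately.

## References

* C. Voisin, *Hodge Theory and Complex Algebraic Geometry I* (2002), §6.1.1, Prop. 6.5, Lemma 6.6
  (pp. 139–140); §6.1.2, Thm. 6.7 (p. 141). [Voisin2002]
* D. Huybrechts, *Complex Geometry. An Introduction* (2005), §3.1, Prop. 3.1.12. [Huybrechts2005]
-/

noncomputable section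

open scoped Manifold ContDiff Topology RealInnerProductSpace ComplexConjugate
open Set Function Bundle Module Filter ContinuousAlternatingMap Complex
open Literature.Geometry.Kaehler

namespace Literature.NumberTheory.Transcendental

set_option quotPrecheck false

set_option hygiene false in
/-- The covector family of the model Lefschetz operator. -/
local notation "θE[" B' "]" => (2⁻¹ : ℝ) • ContinuousLinearMap.comp B'
  ((Complex.I • ContinuousLinearMap.id ℂ E).restrictScalars ℝ)

set_option hygiene false in
/-- The canonical family of the model Lefschetz operator. -/
local notation "LfamE[" B' "]" η:max =>
  ContinuousLinearMap.comp (ContinuousAlternatingMap.alternatizeUncurryFinCLM ℝ E ℂ)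
    (ContinuousLinearMap.comp (ContinuousLinearMap.flip
      (ContinuousLinearMap.smulRightL ℝ E (E [⋀^Fin _]→L[ℝ] ℂ)) η) (θE[B']))

set_option hygiene false in
/-- The model Lefschetz operator. -/
local notation "LopE[" B' "]" η:max =>
  ContinuousAlternatingMap.alternatizeUncurryFin (𝕜 := ℝ) (E := E) (F := ℂ) (LfamE[B'] η)

set_option hygiene false in
/-- The Lefschetz operator on forms on `M`. -/
local notation "Lform[" G' "]" β:max =>
  @id (MForm 𝓘(ℝ, E) M ℂ (_ + 1 + 1)) (fun x ↦ (LopE[G' x] (β x) :))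

set_option hygiene false in
/-- Voisin's operator `P = [∂̄*, L] - i∂` in positive degree. -/
local notation "KP[" G ", " o ", " h₁ ", " h₃ "]" β:max =>
  (dolbeaultBarAdjoint o h₁ (Lform[G] β) - Lform[G] (dolbeaultBarAdjoint o h₃ β) -
    Complex.I • dolbeault β)

set_option hygiene false in
/-- The same operator on `0`-forms. -/
local notation "KP₀[" G ", " o ", " h₁ "]" β:max =>
  (dolbeaultBarAdjoint o h₁ (Lform[G] β) - Complex.I • dolbeault β)

set_option hygiene false in
/-- The same operator in the edge degree `n - 1` (no term `∂̄*(Lβ)`, `Lβ` being of degree `n + 1`). -/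
local notation "KP₁[" G ", " o ", " h₃ "]" β:max =>
  (-(Lform[G] (dolbeaultBarAdjoint o h₃ β)) - Complex.I • dolbeault β)

set_option hygiene false in
/-- `⋆ L ⋆` on `(j+2)`-forms (up to the sign `(-1)^j`, the adjoint `Λ = ⋆⁻¹ L ⋆` of `L`). -/
local notation "SLS[" G ", " o ", " ha ", " hb "]" β:max =>
  (MForm.cHodgeStar o hb (Lform[G] (MForm.cHodgeStar o ha β)))

section Algebra

variable {E : Type*} [NormedAddCommGroup E] [NormedSpace ℂ E]
  {M : Type*} [TopologicalSpace M] [ChartedSpace E M] {k : ℕ}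

/-- Parity bookkeeping: if `a + b = n` with `n` even then `(-1)^{ab} = (-1)^a`. [folklore] -/
theorem neg_one_pow_mul_eq_neg_one_pow {a b n : ℕ} (h : a + b = n) (hn : Even n) :
    ((-1 : ℂ) ^ (a * b)) = (-1) ^ a := by
  rcases Nat.even_or_odd a with ha | ha
  · rw [(Nat.even_mul.2 (Or.inl ha)).neg_one_pow, ha.neg_one_pow]
  · have hb : Odd b := by
      rcases Nat.even_or_odd b with hb | hb
      · exfalso
        have : Odd (a + b) := ha.add_even hb
        rw [h] at this
        exact Nat.not_even_iff_odd.2 this hn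
      · exact hb
    rw [(Nat.odd_mul.2 ⟨ha, hb⟩).neg_one_pow, ha.neg_one_pow]

/-- The model Lefschetz operator is real: it commutes with complex conjugation of forms.
[folklore] -/
theorem lopE_conj (B : E →L[ℝ] E →L[ℝ] ℝ) (η : E [⋀^Fin k]→L[ℝ] ℂ) :
    LopE[B] ((Complex.conjCLE : ℂ →L[ℝ] ℂ).compContinuousAlternatingMap η) =
      (Complex.conjCLE : ℂ →L[ℝ] ℂ).compContinuousAlternatingMap (LopE[B] η) := by
  ext v
  simp only [alternatizeUncurryFin_apply, lfamE_apply, Literature.LinearAlgebra.Alternating.wedgeOne_apply,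
    ContinuousLinearMap.compContinuousAlternatingMap_coe, Function.comp_apply,
    ContinuousLinearEquiv.coe_coe, Complex.conjCLE_apply, _root_.map_sum, zsmul_eq_mul, map_mul,
    map_intCast, Complex.real_smul, Complex.conj_ofReal]

/-- `L` is real: `L ᾱ = \overline{L α}` on forms. [folklore] -/
theorem lform_conj (G : M → E →L[ℝ] E →L[ℝ] ℝ) (β : MForm 𝓘(ℝ, E) M ℂ k) :
    Lform[G] β.conj = (Lform[G] β).conj :=
  funext fun x ↦ lopE_conj (G x) (β x)

/-- `L(-β) = -Lβ` on forms. [folklore] -/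
theorem lform_neg (G : M → E →L[ℝ] E →L[ℝ] ℝ) (β : MForm 𝓘(ℝ, E) M ℂ k) :
    Lform[G] (-β) = -Lform[G] β := by
  rw [← neg_one_smul ℂ β, lform_smul, neg_one_smul]

/-- `\overline{-α} = -ᾱ` (local copy of `MForm.conj_neg` of `KaehlerHodgeConjProofs.lean`, whose
import closure is avoided here). [folklore] -/
private theorem conj_neg_aux (α : MForm 𝓘(ℝ, E) M ℂ k) : (-α).conj = -α.conj := by
  funext x; ext v; simp

/-- `\overline{α - β} = ᾱ - β̄`. [folklore] -/
private theorem conj_sub_aux (α β : MForm 𝓘(ℝ, E) M ℂ k) : (α - β).conj = α.conj - β.conj := by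
  funext x; ext v; simp

/-- `\overline{(-1)^a • α} = (-1)^a • ᾱ` (real scalar). [folklore] -/
private theorem conj_neg_one_pow_smul_aux (a : ℕ) (α : MForm 𝓘(ℝ, E) M ℂ k) :
    (((-1 : ℂ) ^ a) • α).conj = ((-1 : ℂ) ^ a) • α.conj := by
  rw [MForm.conj_smul, map_pow, map_neg, map_one]

/-- `\overline{I • α} = -(I • ᾱ)`. [folklore] -/
private theorem conj_I_smul_aux (α : MForm 𝓘(ℝ, E) M ℂ k) :
    (Complex.I • α).conj = -(Complex.I • α.conj) := by
  rw [MForm.conj_smul, Complex.conj_I, neg_smul]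

variable [FiniteDimensional ℂ E] {n : ℕ} [Fact (finrank ℝ E = n)]
  [RiemannianBundle (fun x : M ↦ TangentSpace 𝓘(ℝ, E) x)]
  (o : (x : M) → Orientation ℝ (TangentSpace 𝓘(ℝ, E) x) (Fin n))

/-- `⋆ᾱ = \overline{⋆α}` (local copy of `MForm.cHodgeStar_conj` of `KaehlerHodgeConjProofs.lean`,
whose import closure is avoided here): the complex star is the `ℂ`-linear extension of the real
one. [folklore] -/
private theorem cHodgeStar_conj_aux {k m : ℕ} (h : k + m = n) (α : MForm 𝓘(ℝ, E) M ℂ k) :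
    MForm.cHodgeStar o h α.conj = (MForm.cHodgeStar o h α).conj := by
  have hre : α.conj.re = α.re := by funext x; ext v; simp [MForm.re_apply]
  have him : α.conj.im = -α.im := by funext x; ext v; simp [MForm.im_apply]
  rw [MForm.cHodgeStar_apply, MForm.cHodgeStar_apply, hre, him, map_neg]
  funext x; ext v
  simp only [Pi.add_apply, Pi.smul_apply, Pi.neg_apply, ContinuousAlternatingMap.add_apply,
    ContinuousAlternatingMap.smul_apply, ContinuousAlternatingMap.neg_apply, MForm.ofReal_apply,
    MForm.conj_apply, map_add, map_mul, Complex.conj_ofReal, Complex.conj_I, smul_eq_mul,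
    Complex.ofReal_neg]
  ring

/-- `∂̄* ᾱ = \overline{∂* α}` (local copy of `dolbeaultBarAdjoint_conj`). [folklore] -/
private theorem dolbeaultBarAdjoint_conj_aux {k m : ℕ} (h : (k + 1) + m = n)
    (α : MForm 𝓘(ℝ, E) M ℂ (k + 1)) :
    dolbeaultBarAdjoint o h α.conj = (dolbeaultAdjoint o h α).conj := by
  simp only [dolbeaultBarAdjoint, dolbeaultAdjoint, cHodgeStar_conj_aux, dolbeault_conj',
    conj_neg_aux]

/-- `⋆ L ⋆` is real. [folklore] -/
theorem sls_conj {j m : ℕ} (G : M → E →L[ℝ] E →L[ℝ] ℝ) (ha : (j + 1 + 1) + m = n)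
    (hb : (m + 1 + 1) + j = n) (β : MForm 𝓘(ℝ, E) M ℂ (j + 1 + 1)) :
    SLS[G, o, ha, hb] β.conj = (SLS[G, o, ha, hb] β).conj := by
  rw [cHodgeStar_conj_aux, lform_conj, cHodgeStar_conj_aux]

/-- Unfolding of `∂̄* = -⋆∂⋆` with a prescribed degree witness for the outer star. [folklore] -/
theorem dolbeaultBarAdjoint_eq_neg_cHodgeStar {k m : ℕ} (h : (k + 1) + m = n) (h' : (m + 1) + k = n)
    (α : MForm 𝓘(ℝ, E) M ℂ (k + 1)) :
    dolbeaultBarAdjoint o h α = -MForm.cHodgeStar o h' (dolbeault (MForm.cHodgeStar o h α)) :=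
  rfl

variable [IsManifold 𝓘(ℝ, E) ∞ M]
  [IsContMDiffRiemannianBundle 𝓘(ℝ, E) ∞ E (fun x : M ↦ TangentSpace 𝓘(ℝ, E) x)]

/-- **`[Λ, ∂] = i∂̄*` from `[∂̄*, L] = i∂` by `⋆`-conjugation**, generic degrees. For a smooth
`(j+2)`-form `β` with `(j+2) + (m'+1) = n`, applying the identity `P = 0` (hypothesis `hP`) to
`⋆β` (a form of positive degree `m' + 1`) and then `⋆` gives
`(-1)^{j+1} ⋆L⋆(∂β) - ∂((-1)^j ⋆L⋆ β) = i ∂̄*β`, i.e. `Λ(∂β) - ∂(Λβ) = i∂̄*β` for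
`Λ = (-1)^{deg - 2} ⋆L⋆ = ⋆⁻¹L⋆`. Voisin (2002), §6.1.1, Prop. 6.5 (the identities (6.3) are
"the adjoints" of `[∂̄*, L] = i∂`); Huybrechts (2005), Prop. 3.1.12 (i) ⇔ (ii) via `⋆`.
[cite: Voisin2002, §6.1.1 Prop. 6.5] -/
theorem sls_comm_dolbeault (ho : IsSmoothForm (riemannianVolumeForm o))
    (G : M → E →L[ℝ] E →L[ℝ] ℝ)
    (hP : ∀ {k m₁ m₃ : ℕ} (h₁ : (k + 1 + 1 + 1) + m₁ = n) (h₃ : (k + 1) + m₃ = n)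
      (α : MForm 𝓘(ℝ, E) M ℂ (k + 1)), IsSmoothForm α → KP[G, o, h₁, h₃] α = 0)
    {j m m' m₀ : ℕ} (ha : (j + 1 + 1) + m = n) (hb : (m + 1 + 1) + j = n)
    (ha' : (j + 1 + 1 + 1) + m' = n) (hb' : (m' + 1 + 1) + (j + 1) = n)
    (h : (j + 1 + 1) + m₀ = n) {β : MForm 𝓘(ℝ, E) M ℂ (j + 1 + 1)} (hβ : IsSmoothForm β) :
    ((-1 : ℂ) ^ (j + 1)) • SLS[G, o, ha', hb'] (dolbeault β) -
        dolbeault (((-1 : ℂ) ^ j) • SLS[G, o, ha, hb] β) =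
      Complex.I • dolbeaultBarAdjoint o h β := by
  obtain rfl : m = m₀ := by omega
  obtain rfl : m = m' + 1 := by omega
  have hn : Even n := (Fact.out : finrank ℝ E = n) ▸ even_finrank_real E
  have h₁ : (m' + 1 + 1 + 1) + j = n := by omega
  have h₃ : (m' + 1) + (j + 1 + 1) = n := by omega
  have hd : (m' + 1 + 1) + (j + 1) = n := by omega
  have he : (j + 1) + (m' + 1 + 1) = n := by omega
  have hα : IsSmoothForm (MForm.cHodgeStar o ha β) := IsSmoothForm.cHodgeStar o ho ha hβ
  have key := congrArg (MForm.cHodgeStar o hd) (hP h₁ h₃ _ hα)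
  -- signs
  have s1 : ((-1 : ℂ) ^ ((j + 1) * (m' + 1 + 1))) = (-1) ^ (j + 1) :=
    neg_one_pow_mul_eq_neg_one_pow (by omega) hn
  have s2 : ((-1 : ℂ) ^ ((j + 1 + 1) * (m' + 1))) = (-1) ^ j := by
    rw [neg_one_pow_mul_eq_neg_one_pow (b := m' + 1) (by omega) hn, pow_succ, pow_succ]; ring
  -- the three terms after applying `⋆`
  have e1 : MForm.cHodgeStar o hd (dolbeaultBarAdjoint o h₁ (Lform[G] (MForm.cHodgeStar o ha β))) =
      ((-1 : ℂ) ^ j) • dolbeault (SLS[G, o, ha, hb] β) := by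
    rw [dolbeaultBarAdjoint_eq_neg_cHodgeStar o h₁ he, map_neg, MForm.cHodgeStar_cHodgeStar_holds o he hd, s1,
      pow_succ, mul_neg_one, neg_smul, neg_neg]
  have e2 : MForm.cHodgeStar o hd (Lform[G] (dolbeaultBarAdjoint o h₃ (MForm.cHodgeStar o ha β))) =
      ((-1 : ℂ) ^ (j + 1)) • SLS[G, o, ha', hb'] (dolbeault β) := by
    rw [dolbeaultBarAdjoint_eq_neg_cHodgeStar o h₃ ha', MForm.cHodgeStar_cHodgeStar_holds o ha h₃, s2,
      dolbeault_smul_holds ((-1 : ℂ) ^ j) β, map_smul, lform_neg, lform_smul, map_neg, map_smul, pow_succ,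
      mul_neg_one, neg_smul]
  have e3 : MForm.cHodgeStar o hd (Complex.I • dolbeault (MForm.cHodgeStar o ha β)) =
      -(Complex.I • dolbeaultBarAdjoint o ha β) := by
    rw [map_smul, dolbeaultBarAdjoint_eq_neg_cHodgeStar o ha hd, smul_neg, neg_neg]
  rw [map_sub, map_sub, _root_.map_zero, e1, e2, e3, sub_neg_eq_add] at key
  rw [dolbeault_smul_holds ((-1 : ℂ) ^ j)]
  -- key : (-1)^j • ∂(SLS β) - (-1)^(j+1) • SLS'(∂β) + I • ∂̄*β = 0
  rw [eq_neg_of_add_eq_zero_right key, neg_sub]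

/-- **`[Λ, ∂] = i∂̄*` at a form of top degree `j + 2 = n`** (where `Λ(∂β) = 0`): from the
identity `P₀ = 0` on functions (hypothesis `hP₀`) applied to the function `⋆β`:
`-∂((-1)^j ⋆L⋆β) = i∂̄*β`. [cite: Voisin2002, §6.1.1 Prop. 6.5] -/
theorem sls_comm_dolbeault_top (ho : IsSmoothForm (riemannianVolumeForm o))
    (G : M → E →L[ℝ] E →L[ℝ] ℝ)
    (hP₀ : ∀ {m₁ : ℕ} (h₁ : (0 + 1 + 1) + m₁ = n) (α : MForm 𝓘(ℝ, E) M ℂ 0),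
      IsSmoothForm α → KP₀[G, o, h₁] α = 0)
    {j m m₀ : ℕ} (ha : (j + 1 + 1) + m = n) (hb : (m + 1 + 1) + j = n) (hm : m = 0)
    (h : (j + 1 + 1) + m₀ = n) {β : MForm 𝓘(ℝ, E) M ℂ (j + 1 + 1)} (hβ : IsSmoothForm β) :
    -dolbeault (((-1 : ℂ) ^ j) • SLS[G, o, ha, hb] β) = Complex.I • dolbeaultBarAdjoint o h β := by
  subst hm
  obtain rfl : m₀ = 0 := by omega
  have hn : Even n := (Fact.out : finrank ℝ E = n) ▸ even_finrank_real E
  have hd : (0 + 1) + (j + 1) = n := by omega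
  have he : (j + 1) + (0 + 1) = n := by omega
  have hα : IsSmoothForm (MForm.cHodgeStar o ha β) := IsSmoothForm.cHodgeStar o ho ha hβ
  have key := congrArg (MForm.cHodgeStar o hd) (hP₀ hb _ hα)
  have s1 : ((-1 : ℂ) ^ ((j + 1) * (0 + 1))) = (-1) ^ (j + 1) :=
    neg_one_pow_mul_eq_neg_one_pow (by omega) hn
  have e1 : MForm.cHodgeStar o hd (dolbeaultBarAdjoint o hb (Lform[G] (MForm.cHodgeStar o ha β))) =
      ((-1 : ℂ) ^ j) • dolbeault (SLS[G, o, ha, hb] β) := by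
    rw [dolbeaultBarAdjoint_eq_neg_cHodgeStar o hb he, map_neg, MForm.cHodgeStar_cHodgeStar_holds o he hd, s1,
      pow_succ, mul_neg_one, neg_smul, neg_neg]
  have e3 : MForm.cHodgeStar o hd (Complex.I • dolbeault (MForm.cHodgeStar o ha β)) =
      -(Complex.I • dolbeaultBarAdjoint o ha β) := by
    rw [map_smul, dolbeaultBarAdjoint_eq_neg_cHodgeStar o ha hd, smul_neg, neg_neg]
  rw [map_sub, _root_.map_zero, e1, e3, sub_neg_eq_add] at key
  rw [dolbeault_smul_holds ((-1 : ℂ) ^ j)]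
  exact (eq_neg_of_add_eq_zero_right key).symm

/-- **`[Λ, ∂] = i∂̄*` on `1`-forms** (`Λ∂β = i∂̄*β`, no term `∂Λβ`): from the identity in the
edge degree `n - 1` (hypothesis `hP₁`: `-L(∂̄*α) - i∂α = 0` for `(n-1)`-forms `α`) applied to
`α = ⋆β`. [cite: Voisin2002, §6.1.1 Prop. 6.5] -/
theorem sls_comm_dolbeault_one (ho : IsSmoothForm (riemannianVolumeForm o))
    (G : M → E →L[ℝ] E →L[ℝ] ℝ)
    (hP₁ : ∀ {k : ℕ} (h₃ : (k + 1) + (0 + 1) = n) (α : MForm 𝓘(ℝ, E) M ℂ (k + 1)),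
      IsSmoothForm α → KP₁[G, o, h₃] α = 0)
    {m m₂ : ℕ} (h : (0 + 1) + m = n) (ha : (0 + 1 + 1) + m₂ = n) (hb : (m₂ + 1 + 1) + 0 = n)
    {β : MForm 𝓘(ℝ, E) M ℂ (0 + 1)} (hβ : IsSmoothForm β) :
    SLS[G, o, ha, hb] (dolbeault β) = Complex.I • dolbeaultBarAdjoint o h β := by
  obtain rfl : m = m₂ + 1 := by omega
  have hn : Even n := (Fact.out : finrank ℝ E = n) ▸ even_finrank_real E
  have h₃ : (m₂ + 1) + (0 + 1) = n := by omega
  have hα : IsSmoothForm (MForm.cHodgeStar o h β) := IsSmoothForm.cHodgeStar o ho h hβ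
  have key := congrArg (MForm.cHodgeStar o hb) (hP₁ h₃ _ hα)
  have s2 : ((-1 : ℂ) ^ ((0 + 1) * (m₂ + 1))) = -1 := by
    rw [neg_one_pow_mul_eq_neg_one_pow (b := m₂ + 1) (by omega) hn]; norm_num
  have e2 : MForm.cHodgeStar o hb (Lform[G] (dolbeaultBarAdjoint o h₃ (MForm.cHodgeStar o h β))) =
      SLS[G, o, ha, hb] (dolbeault β) := by
    rw [dolbeaultBarAdjoint_eq_neg_cHodgeStar o h₃ ha, MForm.cHodgeStar_cHodgeStar_holds o h h₃, s2,
      dolbeault_smul_holds (-1 : ℂ) β, map_smul, neg_one_smul, neg_neg]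
  have e3 : MForm.cHodgeStar o hb (Complex.I • dolbeault (MForm.cHodgeStar o h β)) =
      -(Complex.I • dolbeaultBarAdjoint o h β) := by
    rw [map_smul, dolbeaultBarAdjoint_eq_neg_cHodgeStar o h hb, smul_neg, neg_neg]
  rw [map_sub, _root_.map_zero, map_neg, e2, e3, sub_neg_eq_add] at key
  exact neg_add_eq_zero.1 key

/-! #### The `∂̄`-versions, by complex conjugation -/

/-- **`[Λ, ∂̄] = -i∂*`**, generic degrees: the complex conjugate of `sls_comm_dolbeault` at `β̄`
(`⋆`, `L` are real, `∂ᾱ = \overline{∂̄α}`, `∂̄*ᾱ = \overline{∂*α}`). Voisin (2002), §6.1.1,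
Prop. 6.5, eq. (6.3). [cite: Voisin2002, §6.1.1 Prop. 6.5] -/
theorem sls_comm_dolbeaultBar (ho : IsSmoothForm (riemannianVolumeForm o))
    (G : M → E →L[ℝ] E →L[ℝ] ℝ)
    (hP : ∀ {k m₁ m₃ : ℕ} (h₁ : (k + 1 + 1 + 1) + m₁ = n) (h₃ : (k + 1) + m₃ = n)
      (α : MForm 𝓘(ℝ, E) M ℂ (k + 1)), IsSmoothForm α → KP[G, o, h₁, h₃] α = 0)
    {j m m' m₀ : ℕ} (ha : (j + 1 + 1) + m = n) (hb : (m + 1 + 1) + j = n)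
    (ha' : (j + 1 + 1 + 1) + m' = n) (hb' : (m' + 1 + 1) + (j + 1) = n)
    (h : (j + 1 + 1) + m₀ = n) {β : MForm 𝓘(ℝ, E) M ℂ (j + 1 + 1)} (hβ : IsSmoothForm β) :
    ((-1 : ℂ) ^ (j + 1)) • SLS[G, o, ha', hb'] (dolbeaultBar β) -
        dolbeaultBar (((-1 : ℂ) ^ j) • SLS[G, o, ha, hb] β) =
      -(Complex.I • dolbeaultAdjoint o h β) := by
  have e1 : (SLS[G, o, ha', hb'] (dolbeault β.conj)).conj = SLS[G, o, ha', hb'] (dolbeaultBar β) := by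
    rw [dolbeault_conj', sls_conj, MForm.conj_conj]
  have e2 : (dolbeault (((-1 : ℂ) ^ j) • SLS[G, o, ha, hb] β.conj)).conj =
      dolbeaultBar (((-1 : ℂ) ^ j) • SLS[G, o, ha, hb] β) := by
    rw [sls_conj, ← conj_neg_one_pow_smul_aux, dolbeault_conj', MForm.conj_conj]
  have e3 : (Complex.I • dolbeaultBarAdjoint o h β.conj).conj = -(Complex.I • dolbeaultAdjoint o h β) := by
    rw [conj_I_smul_aux, dolbeaultBarAdjoint_conj_aux, MForm.conj_conj]
  have A := congrArg MForm.conj (sls_comm_dolbeault o ho G hP ha hb ha' hb' h (isSmoothForm_conj hβ))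
  rw [conj_sub_aux, conj_neg_one_pow_smul_aux, e1, e2, e3] at A
  exact A

/-- **`[Λ, ∂̄] = -i∂*` at a form of top degree** (`Λ(∂̄β) = 0`): `-∂̄((-1)^j ⋆L⋆β) = -i∂*β`,
the conjugate of `sls_comm_dolbeault_top`. [cite: Voisin2002, §6.1.1 Prop. 6.5] -/
theorem sls_comm_dolbeaultBar_top (ho : IsSmoothForm (riemannianVolumeForm o))
    (G : M → E →L[ℝ] E →L[ℝ] ℝ)
    (hP₀ : ∀ {m₁ : ℕ} (h₁ : (0 + 1 + 1) + m₁ = n) (α : MForm 𝓘(ℝ, E) M ℂ 0),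
      IsSmoothForm α → KP₀[G, o, h₁] α = 0)
    {j m m₀ : ℕ} (ha : (j + 1 + 1) + m = n) (hb : (m + 1 + 1) + j = n) (hm : m = 0)
    (h : (j + 1 + 1) + m₀ = n) {β : MForm 𝓘(ℝ, E) M ℂ (j + 1 + 1)} (hβ : IsSmoothForm β) :
    -dolbeaultBar (((-1 : ℂ) ^ j) • SLS[G, o, ha, hb] β) = -(Complex.I • dolbeaultAdjoint o h β) := by
  have e2 : (dolbeault (((-1 : ℂ) ^ j) • SLS[G, o, ha, hb] β.conj)).conj =
      dolbeaultBar (((-1 : ℂ) ^ j) • SLS[G, o, ha, hb] β) := by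
    rw [sls_conj, ← conj_neg_one_pow_smul_aux, dolbeault_conj', MForm.conj_conj]
  have e3 : (Complex.I • dolbeaultBarAdjoint o h β.conj).conj = -(Complex.I • dolbeaultAdjoint o h β) := by
    rw [conj_I_smul_aux, dolbeaultBarAdjoint_conj_aux, MForm.conj_conj]
  have A := congrArg MForm.conj (sls_comm_dolbeault_top o ho G hP₀ ha hb hm h (isSmoothForm_conj hβ))
  rw [conj_neg_aux, e2, e3] at A
  exact A

/-- **`[Λ, ∂̄] = -i∂*` on `1`-forms**: `⋆L⋆(∂̄β) = -i∂*β`, the conjugate of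
`sls_comm_dolbeault_one`. [cite: Voisin2002, §6.1.1 Prop. 6.5] -/
theorem sls_comm_dolbeaultBar_one (ho : IsSmoothForm (riemannianVolumeForm o))
    (G : M → E →L[ℝ] E →L[ℝ] ℝ)
    (hP₁ : ∀ {k : ℕ} (h₃ : (k + 1) + (0 + 1) = n) (α : MForm 𝓘(ℝ, E) M ℂ (k + 1)),
      IsSmoothForm α → KP₁[G, o, h₃] α = 0)
    {m m₂ : ℕ} (h : (0 + 1) + m = n) (ha : (0 + 1 + 1) + m₂ = n) (hb : (m₂ + 1 + 1) + 0 = n)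
    {β : MForm 𝓘(ℝ, E) M ℂ (0 + 1)} (hβ : IsSmoothForm β) :
    SLS[G, o, ha, hb] (dolbeaultBar β) = -(Complex.I • dolbeaultAdjoint o h β) := by
  have e1 : (SLS[G, o, ha, hb] (dolbeault β.conj)).conj = SLS[G, o, ha, hb] (dolbeaultBar β) := by
    rw [dolbeault_conj', sls_conj, MForm.conj_conj]
  have e3 : (Complex.I • dolbeaultBarAdjoint o h β.conj).conj = -(Complex.I • dolbeaultAdjoint o h β) := by
    rw [conj_I_smul_aux, dolbeaultBarAdjoint_conj_aux, MForm.conj_conj]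
  have A := congrArg MForm.conj (sls_comm_dolbeault_one o ho G hP₁ h ha hb (isSmoothForm_conj hβ))
  rw [e1, e3] at A
  exact A

end Algebra

/-! ### The contraction family `Λ = ⋆⁻¹L⋆` satisfies the Kähler identities -/

section Assembly

variable {E : Type*} [NormedAddCommGroup E] [NormedSpace ℂ E]
  {M : Type*} [TopologicalSpace M] [ChartedSpace E M]
  [FiniteDimensional ℂ E] {n : ℕ} [Fact (finrank ℝ E = n)]
  [RiemannianBundle (fun x : M ↦ TangentSpace 𝓘(ℝ, E) x)]
  (o : (x : M) → Orientation ℝ (TangentSpace 𝓘(ℝ, E) x) (Fin n))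
  [IsManifold 𝓘(ℝ, E) ∞ M] [IsManifold 𝓘(ℂ, E) ω M]
  [IsContMDiffRiemannianBundle 𝓘(ℝ, E) ∞ E (fun x : M ↦ TangentSpace 𝓘(ℝ, E) x)]

/-- **The first-order Kähler identities in `Λ`-form from their `L`-form** (Voisin (2002), §6.1.1,
Prop. 6.5: `[Λ, ∂̄] = -i∂*`, `[Λ, ∂] = i∂̄*`, eq. (6.3), p. 139, "obtained from" `[∂̄*, L] = i∂`
by passing to adjoints; Huybrechts (2005), Prop. 3.1.12 (i)/(ii)). On a complex manifold with a
smooth Hermitian metric written as the family `G x = gₓ` and an orientation family with smooth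
volume form, suppose the `L`-form identity `P = 0` holds on all smooth forms, in positive degree
(`hP`), on functions (`hP₀`) and in the edge degree `n - 1` (`hP₁`). Then the contraction family
`Λ = (-1)^{j} ⋆L⋆` on `(j+2)`-forms (the adjoint `⋆⁻¹L⋆` of `L`; `0` above the top degree)
satisfies `KaehlerIdentities o Λ` of `KaehlerHodgeLaplacianProofs.lean`, whence `Δ_∂̄ = Δ_∂` and
`Δ_d = 2Δ_∂̄` by the algebra proved there. No new definition: `Λ` is produced existentially.
[cite: Voisin2002, §6.1.1 Prop. 6.5] -/
theorem exists_kaehlerIdentities_of_kaehlerP (ho : IsSmoothForm (riemannianVolumeForm o))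
    (G : M → E →L[ℝ] E →L[ℝ] ℝ) (hG : ∀ (x : M) (v w : TangentSpace 𝓘(ℝ, E) x), G x v w = ⟪v, w⟫)
    (hP : ∀ {k m₁ m₃ : ℕ} (h₁ : (k + 1 + 1 + 1) + m₁ = n) (h₃ : (k + 1) + m₃ = n)
      (α : MForm 𝓘(ℝ, E) M ℂ (k + 1)), IsSmoothForm α → KP[G, o, h₁, h₃] α = 0)
    (hP₀ : ∀ {m₁ : ℕ} (h₁ : (0 + 1 + 1) + m₁ = n) (α : MForm 𝓘(ℝ, E) M ℂ 0),
      IsSmoothForm α → KP₀[G, o, h₁] α = 0)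
    (hP₁ : ∀ {k : ℕ} (h₃ : (k + 1) + (0 + 1) = n) (α : MForm 𝓘(ℝ, E) M ℂ (k + 1)),
      IsSmoothForm α → KP₁[G, o, h₃] α = 0) :
    ∃ Λ : (j : ℕ) → MForm 𝓘(ℝ, E) M ℂ (j + 2) → MForm 𝓘(ℝ, E) M ℂ j, KaehlerIdentities o Λ := by
  classical
  have hn : Even n := (Fact.out : finrank ℝ E = n) ▸ even_finrank_real E
  refine ⟨fun j β ↦ if hj : j + 2 ≤ n then
      ((-1 : ℂ) ^ j) • SLS[G, o, (show (j + 1 + 1) + (n - (j + 2)) = n by omega),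
        (show (n - (j + 2) + 1 + 1) + j = n by omega)] β else 0, ?_, ?_, ?_, ?_, ?_, ?_⟩
  · -- additivity
    intro j β γ
    by_cases hj : j + 2 ≤ n
    · simp only [dif_pos hj, map_add, lform_add, smul_add]
    · simp only [dif_neg hj, add_zero]
  · -- smoothness
    intro j β hβ
    by_cases hj : j + 2 ≤ n
    · simp only [dif_pos hj]
      exact (IsSmoothForm.cHodgeStar o ho _
        (isSmoothForm_lform G hG (IsSmoothForm.cHodgeStar o ho _ hβ))).smul_complex _
    · simp only [dif_neg hj]
      exact isSmoothForm_zero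
  · -- `[Λ, ∂̄] = -i∂*`, degrees `≥ 2`
    intro j m h β hβ
    have hj : j + 2 ≤ n := by omega
    by_cases hj' : j + 1 + 2 ≤ n
    · simp only [dif_pos hj, dif_pos hj']
      exact sls_comm_dolbeaultBar o ho G hP _ _ _ _ h hβ
    · simp only [dif_pos hj, dif_neg hj', zero_sub]
      exact sls_comm_dolbeaultBar_top o ho G hP₀ _ _ (by omega) h hβ
  · -- `[Λ, ∂̄] = -i∂*` on `1`-forms
    intro m h β hβ
    have h0 : 0 + 2 ≤ n := by
      obtain ⟨d, hd⟩ := hn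
      omega
    simp only [dif_pos h0, pow_zero, one_smul]
    exact sls_comm_dolbeaultBar_one o ho G hP₁ h _ _ hβ
  · -- `[Λ, ∂] = i∂̄*`, degrees `≥ 2`
    intro j m h β hβ
    have hj : j + 2 ≤ n := by omega
    by_cases hj' : j + 1 + 2 ≤ n
    · simp only [dif_pos hj, dif_pos hj']
      exact sls_comm_dolbeault o ho G hP _ _ _ _ h hβ
    · simp only [dif_pos hj, dif_neg hj', zero_sub]
      exact sls_comm_dolbeault_top o ho G hP₀ _ _ (by omega) h hβ
  · -- `[Λ, ∂] = i∂̄*` on `1`-forms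
    intro m h β hβ
    have h0 : 0 + 2 ≤ n := by
      obtain ⟨d, hd⟩ := hn
      omega
    simp only [dif_pos h0, pow_zero, one_smul]
    exact sls_comm_dolbeault_one o ho G hP₁ h _ _ hβ

end Assembly

/-! ### `Δ_d = 2Δ_∂̄` on a (Hausdorff) Kähler manifold, from `P = 0` in the edge degree -/

section NamedFact

variable {E : Type*} [NormedAddCommGroup E] [NormedSpace ℂ E]
  {M : Type*} [TopologicalSpace M] [ChartedSpace E M]
  [FiniteDimensional ℂ E] {n : ℕ} [Fact (finrank ℝ E = n)]
  [IsManifold 𝓘(ℂ, E) ω M] [IsManifold 𝓘(ℝ, E) ∞ M] [T2Space M]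
  (g : ContMDiffRiemannianMetric 𝓘(ℝ, E) ∞ E (fun x : M ↦ TangentSpace 𝓘(ℝ, E) x))
  (o : (x : M) → Orientation ℝ (TangentSpace 𝓘(ℝ, E) x) (Fin n))

/-- **The Kähler identity `Δ_d = 2Δ_∂̄` (the corrected named fact
`cHodgeLaplacian_eq_two_smul_dolbeaultLaplacian_of_isManifold_complex g o` of `KaehlerHodge.lean`,
Voisin (2002), Thm. 6.7) on a Hausdorff complex manifold, reduced to the identity `P = 0` in the
single edge degree `n - 1`**: `P = [∂̄*, L] - i∂ = 0` in degrees `≤ n - 2` and on functions is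
the tree's `kaehlerP_apply_eq_zero` / `kaehlerP_apply_eq_zero_zero` (Voisin's Prop. 6.5 by
osculation, `KaehlerIdentityAssemblyProofs.lean`); with the edge degree supplied (`hP₁`),
`exists_kaehlerIdentities_of_kaehlerP` gives the `Λ`-form identities and
`KaehlerIdentities.cHodgeLaplacian_eq_two_smul_dolbeaultLaplacian` (Huybrechts (2005),
Prop. 3.1.12 (iii)) concludes. [cite: Voisin2002, §6.1.2 Thm. 6.7] -/
theorem cHodgeLaplacian_eq_two_smul_dolbeaultLaplacian_of_isManifold_complex_of_kaehlerP₁ {k m : ℕ}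
    (hP₁ : letI : RiemannianBundle (fun x : M ↦ TangentSpace 𝓘(ℝ, E) x) := ⟨g.toRiemannianMetric⟩
      g.toRiemannianMetric.IsKaehler → IsSmoothForm (riemannianVolumeForm o) →
      ∀ {k : ℕ} (h₃ : (k + 1) + (0 + 1) = n) (α : MForm 𝓘(ℝ, E) M ℂ (k + 1)), IsSmoothForm α →
        KP₁[g.inner, o, h₃] α = 0) :
    cHodgeLaplacian_eq_two_smul_dolbeaultLaplacian_of_isManifold_complex (k := k) (m := m) g o := by
  intro hg h α hα
  letI : RiemannianBundle (fun x : M ↦ TangentSpace 𝓘(ℝ, E) x) := ⟨g.toRiemannianMetric⟩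
  haveI : IsContMDiffRiemannianBundle 𝓘(ℝ, E) ∞ E (fun x : M ↦ TangentSpace 𝓘(ℝ, E) x) :=
    ⟨g.inner, g.contMDiff, fun _ _ _ ↦ rfl⟩
  intro ho
  have hG : ∀ (x : M) (v w : TangentSpace 𝓘(ℝ, E) x), g.inner x v w = ⟪v, w⟫ := fun _ _ _ ↦ rfl
  have hH : ∀ (x : M) (v w : E), g.inner x (Complex.I • v) (Complex.I • w) = g.inner x v w :=
    fun x v w ↦ hg.1 x v w
  have hK : IsClosedForm (RiemannianBundle.g (E := fun x : M ↦ TangentSpace 𝓘(ℝ, E) x)).kaehlerForm :=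
    hg.2
  obtain ⟨Λ, hΛ⟩ := exists_kaehlerIdentities_of_kaehlerP o ho g.inner hG
    (fun h₁ h₃ β hβ ↦ funext fun x ↦ kaehlerP_apply_eq_zero o ho g.inner hG hH hK h₁ h₃ β hβ x)
    (fun h₁ β hβ ↦ funext fun x ↦ kaehlerP_apply_eq_zero_zero o ho g.inner hG hH hK h₁ β hβ x)
    (fun h₃ β hβ ↦ hP₁ hg ho h₃ β hβ)
  exact hΛ.cHodgeLaplacian_eq_two_smul_dolbeaultLaplacian ho h hα

/-- **The Kähler identity `Δ_d = 2Δ_∂̄` on a Hausdorff Kähler manifold** — the named fact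
`cHodgeLaplacian_eq_two_smul_dolbeaultLaplacian_of_isManifold_complex g o` of `KaehlerHodge.lean`
(Voisin (2002), §6.1.2, Thm. 6.7: "Let `(X, ω)` be a Kähler manifold … `Δ_∂ = Δ_∂̄ = ½Δ_d`";
Huybrechts (2005), Prop. 3.1.12 (iii)), for every complex manifold `M` with `[T2Space M]`, every
smooth metric `g` (the statement is vacuous unless `g` is Kähler) and orientation family `o`, in
all degrees `k + m = n`: the edge-degree identity is `kaehlerP_apply_eq_zero_one`
(`KaehlerIdentityEdgeDegreeProofs.lean`), the rest is
`cHodgeLaplacian_eq_two_smul_dolbeaultLaplacian_of_isManifold_complex_of_kaehlerP₁`. On the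
separation hypothesis (absent from the `def`, stronger than the source) see the module docstring.
[cite: Voisin2002, §6.1.2 Thm. 6.7] -/
theorem cHodgeLaplacian_eq_two_smul_dolbeaultLaplacian_of_isManifold_complex_of_t2Space {k m : ℕ} :
    cHodgeLaplacian_eq_two_smul_dolbeaultLaplacian_of_isManifold_complex (k := k) (m := m) g o := by
  refine cHodgeLaplacian_eq_two_smul_dolbeaultLaplacian_of_isManifold_complex_of_kaehlerP₁ g o ?_
  intro hg ho k h₃ α hα
  letI : RiemannianBundle (fun x : M ↦ TangentSpace 𝓘(ℝ, E) x) := ⟨g.toRiemannianMetric⟩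
  haveI : IsContMDiffRiemannianBundle 𝓘(ℝ, E) ∞ E (fun x : M ↦ TangentSpace 𝓘(ℝ, E) x) :=
    ⟨g.inner, g.contMDiff, fun _ _ _ ↦ rfl⟩
  have hG : ∀ (x : M) (v w : TangentSpace 𝓘(ℝ, E) x), g.inner x v w = ⟪v, w⟫ := fun _ _ _ ↦ rfl
  have hH : ∀ (x : M) (v w : E), g.inner x (Complex.I • v) (Complex.I • w) = g.inner x v w :=
    fun x v w ↦ hg.1 x v w
  exact funext fun x ↦ kaehlerP_apply_eq_zero_one o ho g.inner hG hH hg.2 h₃ α hα x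

/-- The same, in the shape consumed by the Hodge-decomposition assembly
`Literature.AlgebraicGeometry.Motives.isInternal_hodgePQ_of_hodgeTheorem_of_kaehlerIdentity`
(`HodgeDecompositionIsInternalProofs.lean`, hypothesis `hK`): for a Hausdorff `M`, the Kähler
identity for all real dimensions `n`, smooth metrics, orientation families and degrees.
[cite: Voisin2002, §6.1.2 Thm. 6.7] -/
theorem forall_cHodgeLaplacian_eq_two_smul_dolbeaultLaplacian_of_isManifold_complex_of_t2Space :
    ∀ {n : ℕ} [Fact (finrank ℝ E = n)]
      (g : ContMDiffRiemannianMetric 𝓘(ℝ, E) ∞ E (fun x : M ↦ TangentSpace 𝓘(ℝ, E) x))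
      (o : (x : M) → Orientation ℝ (TangentSpace 𝓘(ℝ, E) x) (Fin n)) {k m : ℕ},
      cHodgeLaplacian_eq_two_smul_dolbeaultLaplacian_of_isManifold_complex (k := k) (m := m) g o :=
  fun g o ↦ cHodgeLaplacian_eq_two_smul_dolbeaultLaplacian_of_isManifold_complex_of_t2Space g o

end NamedFact

end Literature.NumberTheory.Transcendental
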